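import Mathlib
import HarnessLib
import HarnessLib.Audit
import Summits.FinalStateConjecture.Statement
import Literature.Geometry.Lorentzian.QuasiFinalStateDecomposition

/-!
Route: LogTimeThreeAnnuli

DORMANT since 2026-09-04T18:31:30Z (reconciler: no traction for 5 d (last activity statement-checked at 2026-08-30T17:33:52Z); parked, not closed — `ledger route dormant route-FinalStateConjecture-LogTimeThreeAnnuli --off` to reactivate) — unstaffed, not closed; items shared with open routes are served there. `ledger route dormant <id> --off` reactivates.

# Route LogTimeThreeAnnuli — subconvergence to the Kerr family plus log-time renewal bookkeeping of
Price tails gives Cauchy parameters and one chart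

It suffices to show X = SubconvergentEraGeneric ∧ DyadicCapture (∧ the shared support MGHDExists),
realising card
log-time-price-gap-three-annuli-v2 as the CONSUMER of every "ω-limit ⊂ Kerr family" route.
SubconvergentEraGeneric (import, ONE
generic clause because curve-genericity is not closed under ∧): for TAME Christodoulou-generic
admissible data (re-type T2: witness curves on one fixed end, immersed) every
MGHD has complete 𝓘⁺ and an HONEST SUBCONVERGENT FINAL ERA — a reference chart system with the
geometry of an N-hole decomposition (late hole charts on boosted
Kerr exteriors, flat chart, separation, sublinear excision, causal exhaustion of O = J⁺(ιX) ∩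
I⁻(charted) with honest radii, rays stay in closure O,
orthochronous motions, future-oriented chart time — all verbatim or uniform forms of the re-typed
Statement's clauses) in which the radiation zone converges to η in every Cᵏ and each near zone {t*ᵢ
= τ, rᵢ ≤ R} is, for every k, R
and ε, eventually ε-close in Cᵏ to SOME member (M, a) of a compact sub-extremal window m₀ ≤ M ≤
1/m₀, |a| ≤ χM (χ < 1), the member
being free to wander with τ. DyadicCapture (this line's claim, pointwise, no genericity): such an
era upgrades to the Statement's
conclusion — ONE C² FinalStateDecomposition with sub-extremal holes, O = exteriorOf charted,
RaysStayInClosure, HasExhaustiveCharts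
(honest radii), IsFutureOriented — because in
logarithmic time the distance to the family is dyadically summable (DyadicSummability), so the
fitted parameters are Cauchy.
Lean: `SubconvergentEraGeneric ∧ DyadicCapture ∧ MGHDExists`

## Assembly
Pure logic, sorry-free in Sketch.lean / glue.lean (theorem `closes`, axioms
propext/choice/Quot.sound): fix X and an exceptional
datum d of the Statement's property; pointwise on the admissible class MGHDExists supplies the
anti-vacuity conjunct and DyadicCapture
turns "∀ MGHD: complete 𝓘⁺ ∧ subconvergent era" into "∀ MGHD: complete 𝓘⁺ ∧ settles (sub-extremal, O
= exteriorOf, rays stay, exhaustive, future-oriented)", so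
d is exceptional for the property of SubconvergentEraGeneric, whose tame immersed admissible curve
through d (one fixed end) serves verbatim —
monotonicity of IsTameChristodoulouGeneric in the property. DyadicSummability and DiscreteRenewal
are the mechanism made refutable
(layer-2 glue DyadicSummability → CauchyRechart → DyadicCapture foreseen below), not hypotheses of
`closes`.

Rationale: WHY THIS LINE. Change the clock to s = log τ and do the bookkeeping on dyadic chart-time annuli A_n
= [2ⁿ, 2ⁿ⁺¹]: the distance δ_n of a near zone to
the Kerr family obeys a RENEWAL inequality δ_{n+1} ≤ θδ_n + Σ_{j≤n} K_{n−j}δ_j + g_n + Cδ_n², where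
θ < 1 is the intrinsic near-zone
contraction modulo moduli and gauge (red-shift + leakage through trapping given the collar data: the
linear near-zone theory on
exact sub-extremal Kerr, arXiv:1402.7034, arXiv:2007.07211, arXiv:2302.08916), K is the back-scatter
MEMORY KERNEL, summable in
dyadic lag precisely because Price-law tails are polynomial, i.e. exponential in s (Hintz
arXiv:2004.01664, AAG arXiv:2102.11884,
Ma–Zhang arXiv:2008.11429, and on slowly varying backgrounds Metcalfe–Tataru–Tohaneanu
arXiv:1104.5437, Looi
doi:10.1016/j.jmaa.2022.126939), g_n is the datum's far-field drizzle plus the other holes' fields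
(ℓ ≥ 2 suppressed by (R/τ)^ℓ,
ℓ ≤ 1 slaved to the charges by the constraints) and the quadratic fluxes are paid by the Bondi-mass
and area budgets; a discrete
Young/renewal lemma (DiscreteRenewal, Mathlib-level) then gives Σδ_n < ∞, Cauchy parameters by local
rigidity of the Kerr family,
and one chart per hole — the structure of Simon's uniqueness-of-limits scheme (doi:10.2307/2006981,
Allard–Almgren
doi:10.2307/2006984, Cheeger–Tian doi:10.1007/bf01231543) and of log-time normal attraction of a
family of equilibria (Gallay–Wayne
doi:10.1007/s002050200200), transplanted with the dictionary annulus ↦ dyadic chart-time slab,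
neutral modes ↦ Kerr moduli ⊕
Poincaré gauge (Wald doi:10.1063/1.1666203), forcing ↦ collar influx. Imported areas:
geometric-analysis uniqueness of tangent
objects, renewal/Volterra inequalities, invariant-manifold language; what the line does that
QuietWindowCapture (capture by a Kerr
stability theorem from one quiet leaf), TwoBoundarySqueeze (Łojasiewicz on a first-law deficit,
needs a BMS-invariant J) and
TangentConeAtIPlus (blow-down cones) do not: it consumes orbital subconvergence for ALL late times
and upgrades it with the LINEAR
theory at the limit plus budgets — no continuation argument, no Łojasiewicz inequality, no
analyticity. The planner corrected the
card: the 'gap' is red-shift/QNM leakage, not Price's exponent, and Price's law is the summability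
of the memory kernel (NOTES.md
§Design decisions); negatives index empty at filing.

RANKED CRUXES. #2 DyadicCapture (crux) — For every admissible datum, every maximal vacuum Cauchy
development with complete 𝓘⁺ which carries an HONEST SUBCONVERGENT FINAL ERA — m₀ > 0, χ < 1, a
region O, a reference chart system d : QuasiFinalStateDecomposition O 2 ⊤ (the chart geometry of an
N-hole decomposition, closeness vacuous) and growing radii Rᵢ with: O = exteriorOf charted(d); every
future-complete normalised null ray from the data stays in closure O (RaysStayInClosure, re-type T2
(C)); honest radii Rᵢ → ∞, Rᵢ ≥ max(r₊(Mᵢ,aᵢ),0) + 1 (T2 (B)); causal exhaustion of O by the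
certified regions for every chart time τ₁ > τ₀; orthochronous motions Λᵢ and future-oriented chart
time on the certified slabs (eventually in τ every g-future-directed causal vector tangent to the
image of {t*ᵢ = τ, rᵢ ≤ ρ} has dt*ᵢ > 0 — the (M,a)-uniform covector form — and the flat chart's ∂₀
is future-directed on {x⁰ = τ}) (T2 (B)); flat zone → η in every Cᵏ; for every hole i, k, ρ and ε >
0, eventually window parameters m₀ ≤ M ≤ 1/m₀, |a| ≤ χM with the Cᵏ deviation of (chart i)^*g from
boosted Kerr–Schild (Λᵢ, cᵢ, M, a) at most ε on {t*ᵢ = τ, rᵢ ≤ ρ} and on {t*ᵢ = τ, rᵢ ≤ Rᵢ(τ)} —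
settles down exactly as the re-typed Statement demands: some O' and a C² FinalStateDecomposition d'
of O' with every hole sub-extremal, O' = exteriorOf charted(d'), RaysStayInClosure O',
HasExhaustiveCharts d' (honest radii) and IsFutureOriented d'. Card items K2 + K3 + the rechart glue
(one chart per hole from Cauchy parameters). [difficulty: open-problem] (why it might fail:
(Mᵢ,|aᵢ|) may wander: J̇ has no sign and ΔJ=(m/ω)ΔE per mode, so aᵢ converges only via Σ|ΔJ| ≲
incident energy ≲ Bondi budget, a physical-space bound on a DYNAMICAL background known only
mode-wise on exact Kerr; constants degenerate as χ→1 (zero-damped modes); closeness unweighted in r,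
no KS norms.) [arXiv:2104.11857, arXiv:2205.14808, arXiv:2007.07211, arXiv:2302.08916,
arXiv:1402.7034, doi:10.1086/153180]
#4 DyadicSummability (crux) — Under the same hypotheses (admissible datum, MGHD with complete 𝓘⁺, an
honest subconvergent final era exactly as in DyadicCapture), there is a reference chart system
satisfying the SAME honest era clauses in which, for every hole i, order k and radius ρ, from some
dyadic index n₀ on the dyadic suprema of the distance to the window family are summable: Σ_n sup
over τ ∈ [2^(n₀+n), 2^(n₀+n+1)] of inf over m₀ ≤ M ≤ 1/m₀, |a| ≤ χM of the Cᵏ deviation of (chart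
i)^*g from boosted Kerr–Schild (Λᵢ, cᵢ, M, a) on {t*ᵢ = τ, rᵢ ≤ ρ} is finite — the card's Σδ_k < ∞,
the quantitative heart (renewal inequality: near-zone slaving θ, memory kernel K ∈ ℓ¹, drizzle g ∈
ℓ¹, quadratic fluxes budgeted; then DiscreteRenewal). [difficulty: open-problem] (why it might fail:
ℓ≤1 drizzle (infalling mass/momentum aspect of o₂(r⁻¹) data) must be slaved to the charges via the
constraints; for N≥2 companions' late emission/torque must be ℓ¹ at the receiver; compactness
transfer needs a tame slab gauge, quadratic terms O(δ²) after derivative loss by trapping; θ(χ)→1 as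
χ→1.) [arXiv:2004.01664, arXiv:2102.11884, arXiv:2111.04489, arXiv:1104.5437,
doi:10.1016/j.jmaa.2022.126939, arXiv:2104.11857]
#5 SubconvergentEraGeneric (crux) — IMPORT (the producers are the ω-limit / Liouville / quiet-window
/ kinetic-rigidity routes together with generic censorship and generic sub-extremality): for every
connected Hausdorff second-countable smooth 3-manifold X, the property "EVERY maximal vacuum Cauchy
development of the datum has complete 𝓘⁺ (Summit.FinalStateConjecture.HasCompleteNullInfinity) AND
carries an honest subconvergent final era (as in DyadicCapture: reference N-hole chart geometry with
O = exteriorOf charted, RaysStayInClosure O, honest radii, causal exhaustion, orthochronous motions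
and future-oriented chart time on the certified slabs, flat zone → η in every Cᵏ, near zones
eventually ε-close in every Cᵏ on fixed and on growing slabs to SOME Kerr of a compact sub-extremal
window, the member free to wander)" is TAME Christodoulou-generic of codimension ≥ 1 in
admissibleVacuumData X (InitialDataSet.IsTameChristodoulouGeneric … 1, re-type T2 (A): witness
families live on ONE fixed asymptotically flat end with continuous mass, are weighted-C² continuous
and immersed at c = 0). One generic clause only, because curve-genericity is monotone but not closed
under ∧. [difficulty: open-problem] (why it might fail: Contains weak cosmic censorship and 'ω-limit
⊂ sub-extremal Kerr' outright (AIK rigidity only near Kerr); extremal limits and rough-tailed data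
(Cᵏ-closeness asked for ALL k, admissible tails control 2 derivatives at i⁰) must now be escaped by
TAME IMMERSED curves on the fixed end.) [DafermosLuk2017, Christodoulou1999, arXiv:2402.10190,
arXiv:2211.15742, AlexakisIonescuKlainerman2010, arXiv:2403.03470]
#9 DiscreteRenewal (support) — Discrete renewal / Young lemma (card P1): nonnegative sequences with
δ_{n+1} ≤ θδ_n + Σ_{j≤n} K_{n−j}δ_j + g_n, K, g ∈ ℓ¹, ΣK + θ < 1 are summable with Σδ ≤ (δ₀ + Σg)/(1
− θ − ΣK). Pure real analysis over Mathlib. PROVED in the tree as `Theorems.discreteRenewal_proof`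
(Theorems/LogTimeThreeAnnuliDiscreteRenewal.lean, former item stmt-FinalStateConjecture-14486), but
that module imports this route file, so the gate cannot link it (`_holds` import cycle); restated
here with the smallness hypothesis written `ΣK + θ < 1` (logically identical; the landed proof still
elaborates against it) so that the route file renders. PROVERS: re-close ONLY from a module that
does NOT import this Theses file (state the type inlined; the 40-line proof transfers verbatim).
[difficulty: provable-now] [doi:10.2307/2006981, doi:10.1007/bf01231543]
#9 MGHDExists (support) — Every admissible datum has a maximal vacuum Cauchy development over the
repaired structure (Choquet-Bruhat–Geroch 1969 Thm 3, Sbierski 2016 Thm 2.6) — the anti-vacuity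
conjunct of the Statement; filed with the verbatim signature of the sibling routes' shared item
stmt-FinalStateConjecture-9937 so that it deduplicates onto it. [difficulty: XL]
[ChoquetBruhatGeroch1969CMP, Sbierski2016AHP, Ringstrom2009]

TWO-LAYER PLAN. DyadicCapture ⇐ DyadicSummability → CauchyRechart → DyadicCapture (k = 2, depth 1):
CauchyRechart = "an era system with dyadically
summable distance to the window family yields the Statement's decomposition" (local rigidity |p −
p'| ≲ dist of near-zone geometries,
so fitted (M, a) are Cauchy with a sub-extremal limit; build the exact chart by composing the
reference chart with slowly frozen
Kerr symmetries; re-verify O = exteriorOf, rays-stay, exhaustion and future orientation for the new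
charts). DyadicSummability ⇐ NearZoneSlaving (linear, filed
informally at open, rank 3) → SummableInflux (filed informally at open, rank 6) → NonlinearTransfer
(contradiction–compactness on
annulus triples in a tame slab gauge; card K2) → DyadicSummability (k = 3). SubconvergentEraGeneric
⇐ CensoredOmegaLimit (generic:
complete 𝓘⁺ ∧ ω-limit ⊂ sub-extremal Kerr family, from sibling routes) → GaugeAbsorption
(Fermi/co-rotating recentering of the
producer's charts) → SubconvergentEraGeneric. Nothing here is filed now.

KILL CRITERIA. refuted:DyadicCapture by a vacuum MGHD with a subconvergent era whose intrinsic
parameters wander forever (an eternal angular-momentum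
exchange with an ultra-low-frequency exterior field, or an N ≥ 2 configuration with non-summable
mutual forcing) closes the route
outright (`close --reason refuted:DyadicCapture`) and hands the witness to
typed-settling-is-shape-settling as negative knowledge.
refuted:DyadicSummability alone (summability fails but parameters still converge, e.g. δ_n ~ 1/n
driven by an admissible drizzle the
planner mis-estimated) forces the pivot "CauchyRechart from δ_n → 0 plus charge budgets only" —
restate, do not close. A LINEAR
counterexample to NearZoneSlaving on some sub-extremal Kerr (a finite-energy linearised-gravity
solution with zero collar data that
does not contract modulo moduli ⊕ gauge over long windows — a neutral non-modulus mode) kills the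
mechanism: close `refuted` unless it
is an artefact of gauge. refuted:SubconvergentEraGeneric through an open set of data with incomplete
𝓘⁺ is ¬WCC and kills every route
of the summit as typed. The route is mooted (superseded) if SettleThenCensor's AsymptoticStability
child or QuietWindowCapture's
Capture is proved in a form consuming only orbital closeness.

NOT DECOMPOSED YET. The linear near-zone slaving statement for linearised gravity (cannot be typed:
no linearised-Einstein/Teukolsky solution class with
collar data in the prelude) and the influx functional (Hawking-mass differences on a timelike tube,
TimelikeTubeEnergyFlux.lean, or a
Landau–Lifshitz current) are filed as INFORMAL cruxes right after open; the slice lemma (locally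
unique smooth optimal fit near the
Kerr orbit), the local rigidity constant of the Kerr family on near zones, the tame slab gauge, the
regime split N = 0 / N = 1 /
N ≥ 2 and the κ-dependence of all constants near extremality are layer-2 material under
DyadicSummability / CauchyRechart. The
scalar-wave shadow of NearZoneSlaving on exact Kerr (DRSR boundedness + ILED + cutoff) is provable
from the vendored gr.S24 facts and
is a `--supports` lemma, not an item.

CHEAPEST FALSIFIER. Linear and runnable by a refuter with QNM/tail asymptotics or a 1+1
Regge–Wheeler/Teukolsky evolution: on Schwarzschild and on Kerr
with a/M = 0.9, 0.99, evolve ℓ = 2 data supported in r ≤ 10M, record the Cᵐ size on {r ≤ 10M} over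
14 dyadic windows and the collar
size on {10M ≤ r ≤ 20M}; the renewal structure predicts (near-zone size on A_{n+1}) ≤ θ·(size on
A_n) + C·(collar size on A_n ∪
A_{n+1}) with θ < 1 once windows exceed the ringdown time, and collar/near-zone ratio → O(1) in the
tail era (the tail is influx-fed).
A near-zone signal persisting with NEGLIGIBLE collar data over many windows (a neutral non-modulus
linear mode) kills NearZoneSlaving
and the line. Not run here (no kit in plancard mode); the planner's paper analysis of dips/Remez
conspiracies (NOTES.md) already
killed the card's original uniform three-annulus alternative and produced the renewal form filed
here.

NUMBERS. Price exponents (memory kernel): scalar ℓ-mode tails τ^(−2ℓ−3) on sub-extremal Kerr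
(arXiv:2004.01664 Thm 1.1; arXiv:2102.11884),
Teukolsky s = ±2: τ^(−7) … with identified leading coefficients (arXiv:2008.11429, arXiv:2302.06946)
⇒ K_m ≍ 2^(−3m) or faster in
dyadic lag. Intrinsic contraction: QNM/red-shift decay e^(−c(χ)τ/M), c → 0 as χ = |a|/M → 1
(zero-damped modes), so θ per dyadic
window is super-exponentially small at late times for fixed χ < 1. Drizzle: admissible data h −
h_Schw = o₂(r⁻¹), k = o₁(r⁻²) ⇒
deviation energy beyond radius r is o(1/r); near-zone response to wavelength-τ forcing in multipole
ℓ suppressed by (R/τ)^ℓ.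
Perturbative reach of capture theorems: |a| ≪ M (arXiv:2104.11857, arXiv:2205.14808), Schwarzschild
codimension-3 (arXiv:2104.08222),
linear Teukolsky all |a| < M (arXiv:2007.07211, arXiv:2302.08916). Items at open: 6 typed (3 cruxes,
2 support, assembly) + 2
informal cruxes filed after open; longest signature 3385 chars (DyadicSummability).

DEFINITION REQUESTS. (1) notion `SubconvergentEra 𝒟 m₀ χ O d R` (topic
Literature/Geometry/Lorentzian, next to QuasiFinalStateDecomposition): the
conjunction of era clauses inlined verbatim in DyadicCapture / DyadicSummability /
SubconvergentEraGeneric (O = exteriorOf charted,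
causal exhaustion, flat Cᵏ-convergence for all k, windowed near-zone subconvergence on fixed and
growing slabs), so that tenure can
restate the three items compactly and file CauchyRechart over it. (2) notion `collarDeviationCk` (Cᵏ
distance to the window family
on collar slabs {t* = τ, R ≤ r ≤ R'}) and an influx functional on a timelike tube of a
`CauchyDevelopment` (port of
`TimelikeTubeEnergyFlux` bookkeeping), needed to type SummableInflux. (3) cite facts wanted over the
prelude: Price-law memory-kernel
bounds for the forced scalar wave / Teukolsky equation on sub-extremal Kerr in dyadic form
(arXiv:2004.01664 Thm 4.5,
arXiv:2008.11429), and linear stability of Kerr modulo moduli for |a| ≪ M (arXiv:1903.03859,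
arXiv:1906.00860) as named hypotheses
NearZoneSlaving provers will want.

Novelty: Searches (2026-08-15): card-level searches by the ideate and novelty-audit units (crossref "three
annulus lemma wave equation" 0/5,
"normally hyperbolic invariant manifold Kerr family" 0, galaxy "three annulus lemma" --star all 1
hit, frontier 30 rows none on
uniqueness-of-limit technology; refuter: Gallay–Wayne doi:10.1007/s002050200200 and
Baskin–Vasy–Wunsch arXiv:1212.5141 as uncited
prior art); this session: `lit search --hybrid "three annulus lemma" --no-graph` (10 held docs, none
relevant), `lit galaxy search
"three annulus lemma" --star all` (1: pdf:5293026900 Lotay–Schulze–Székelyhidi, read pp. 14–16: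
Prop. 3.9/3.11 = the modern
contradiction + log-convexity form, parabolic), `lit galaxy search "3-annulus lemma" --star all`
(0), `lit search --source crossref
"Price law nonstationary spacetimes"` (6: Looi doi:10.1016/j.jmaa.2022.126939 relevant), `lit search
--source crossref "asymptotic
stability Kerr orbital stability convergence final parameters"` (5: Whiting doi:10.1063/1.528308,
rest irrelevant), `lit search
--source crossref "three annulus lemma uniqueness of limits wave equation"` (6, none relevant);
searchd hybrid/arXiv legs
unavailable (rc 75) part of the session, logged in NOTES.md.
Nearest prior art found: doi:10.2307/2006981 + doi:10.2307/2006984 + doi:10.1007/bf01231543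
(three-annulus/integrability uniqueness of
limits — elliptic/parabolic, compact cross-sections or Riemannian ends); doi:10.1007/s002050200200
(log-time normal attraction of a
family of equi  [refs: 10.1007/s002050200200, 10.1016/j.jmaa.2022.126939, 10.1063/1.528308, 10.2307/2006981, 10.2307/2006984, 10.1007/bf01231543, 1212.5141, 1104.5437, 2104.11857, 2205.14808, doi:10.1007/s002050200200, doi:10.1016/j.jmaa.2022.126939, doi:10.1063/1.528308, doi:10.2307/2006981, doi:10.2307/2006984, doi:10.1007/bf01231543]

Barriers (technique_class: log-time-RG, renewal-inequality, three-annulus): - technique_class: log-time-RG, renewal-inequality, contradiction-compactness,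
three-annulus-integrability
- Literature.Barriers.FinalStateConjecture.PriceLawTail: used as the ENGINE's kernel bound, never
contradicted — no decay faster than the class-limited polynomial one is asserted anywhere
(DyadicSummability asks only Σ over dyadic windows, implied by any τ^(−p), p > 0); the barrier's
technique class (uniform exponential decay / resonance expansions in e^(−t)) is evaded by
compactifying in e^(−s) = 1/τ.
- Literature.Barriers.FinalStateConjecture.AretakisInstability: evaded by the window |a| ≤ χM, χ <
1, carried by the era hypothesis and made generic inside SubconvergentEraGeneric; all constants are
allowed to degenerate as χ → 1 and nothing uniform in spin is claimed; exactly extremal limits sit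
in the exceptional set (consistent with arXiv:2211.15742).
- Literature.Barriers.FinalStateConjecture.AretakisInstabilityNarrow: same — no item asserts Cᵏ
convergence at a degenerate horizon.
- Literature.Barriers.FinalStateConjecture.KerrSuperradiance: the contraction θ is stated modulo
moduli with collar forcing and is paid by red-shift AT the horizon plus leakage, measured in
horizon-penetrating slabs; superradiant amplification is finite for |a| < M (real-axis mode
stability arXiv:2007.07211) and is charged to the constant C(χ), not to a sign-definite ∂ₜ-energy.
- Literature.Barriers.FinalStateConjecture.SlowlyRotatingKerrFrontier: it does not evade it for the
NONLINEAR transf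

History (route lifecycle, newest last):
- 2026-08-16T23:20:23Z · rev 2: restated DyadicCapture (stmt-FinalStateConjecture-14483), DyadicSummability (stmt-FinalStateConjecture-14484), SubconvergentEraGeneric (stmt-FinalStateConjecture-14485), DiscreteRenewal (stmt-FinalStateConjecture-14486 proved), Assembly (stmt-FinalStateConjecture-14487 proved) — route-repair (statement-revised p (planner-rrepair-FinalStateConjecture-LogTimeTh-090e3159-0)
- 2026-08-25T10:07:54Z · DORMANT — reconciler: no traction for 7.6 d (last activity item-evidence-added at 2026-08-17T19:11:08Z); parked, not closed — `ledger route dormant route-FinalStateConjec (operator:999:2964072)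
- 2026-08-30T17:07:20Z · REACTIVATED (open) — reconciler: reactivated — activity statement-checked at 2026-08-30T15:54:01Z after parking at 2026-08-25T10:07:54Z (operator:999:447970)
- 2026-09-04T18:31:30Z · DORMANT — reconciler: no traction for 5 d (last activity statement-checked at 2026-08-30T17:33:52Z); parked, not closed — `ledger route dormant route-FinalStateConjecture (operator:999:2099395)

sub-problem: FinalStateConjecture · status: dormant · opened planner-plancard-FinalStateConjecture-FinalSt-c574d4f8-0 2026-08-15T19:08:51Z · rev 5 · ledger route-FinalStateConjecture-LogTimeThreeAnnuli
GENERATED by the gate from the ledger (D-0016/17). Provers cite these decls: `theorem foo : Summit.FinalStateConjecture.FinalStateConjecture.Theses.LogTimeThreeAnnuli.<Decl> := …` in Summits/FinalStateConjecture/FinalStateConjecture/Theorems/<Name>.lean.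
-/

namespace Summit.FinalStateConjecture.FinalStateConjecture.Theses.LogTimeThreeAnnuli

open scoped BigOperators Topology Manifold Classical MeasureTheory ProbabilityTheory Matrix InnerProductSpace ComplexConjugate ContinuousMap
open Filter Set Function TopologicalSpace MeasureTheory

attribute [summit_statement] _root_.FinalStateConjecture

-- earlier DyadicCapture (stmt-FinalStateConjecture-14483, replaced 2026-08-16T23:20:23Z -> stmt-FinalStateConjecture-17488): retired by None — open Literature.Geometry.Lorentzian in ∀ (X : Type) [TopologicalSpace X] [ChartedSpace E3 X] [IsManifold (𝓡 3) ((⊤ : ℕ∞) : WithTop ℕ∞) X] [T2Space X] [SecondCountableTopology X] [ConnectedSpace X], ∀ D ∈ admissibleVacuumData X, ∀ 𝒟 : VacuumCauchyDevelopment D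
/-- item stmt-FinalStateConjecture-17488 · crux · rank 2 · open · by planner
why it might fail: (Mᵢ,|aᵢ|) may wander: J̇ has no sign and ΔJ=(m/ω)ΔE per mode, so aᵢ converges only via Σ|ΔJ| ≲ incident energy ≲ Bondi budget, a physical-space bound on a DYNAMICAL background known only mode-wise on exact Kerr; constants degenerate as χ→1 (zero-damped modes); closeness unweighted in r, no KS norms.
sources: arXiv:2104.11857, arXiv:2205.14808, arXiv:2007.07211, arXiv:2302.08916, arXiv:1402.7034, doi:10.1086/153180
[crux] For every admissible datum, every maximal vacuum Cauchy development with complete 𝓘⁺ which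
carries an HONEST SUBCONVERGENT FINAL ERA — m₀ > 0, χ < 1, a region O, a reference chart system d :
QuasiFinalStateDecomposition O 2 ⊤ (the chart geometry of an N-hole decomposition, closeness
vacuous) and growing radii Rᵢ with: O = exteriorOf charted(d); every future-complete normalised null
ray from the data stays in closure O (RaysStayInClosure, re-type T2 (C)); honest radii Rᵢ → ∞, Rᵢ ≥
max(r₊(Mᵢ,aᵢ),0) + 1 (T2 (B)); causal exhaustion of O by the certified regions for every chart time
τ₁ > τ₀; orthochronous motions Λᵢ and future-oriented chart time on the certified slabs (eventually
in τ every g-future-directed causal vector tangent to the image of {t*ᵢ = τ, rᵢ ≤ ρ} has dt*ᵢ > 0 —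
the (M,a)-uniform covector form — and the flat chart's ∂₀ is future-directed on {x⁰ = τ}) (T2 (B));
flat zone → η in every Cᵏ; for every hole i, k, ρ and ε > 0, eventually window parameters m₀ ≤ M ≤
1/m₀, |a| ≤ χM with the Cᵏ deviation of (chart i)^*g from boosted Kerr–Schild (Λᵢ, cᵢ, M, a) at most
ε on {t*ᵢ = τ, rᵢ ≤ ρ} and on {t*ᵢ = τ, rᵢ ≤ Rᵢ(τ)} — settles down exactly as the re-typed Statement
demands -/
@[route_item "route-FinalStateConjecture-LogTimeThreeAnnuli"]
def DyadicCapture : Prop :=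
  open Literature.Geometry.Lorentzian in ∀ (X : Type) [TopologicalSpace X] [ChartedSpace E3 X] [IsManifold (𝓡 3) ((⊤ : ℕ∞) : WithTop ℕ∞) X] [T2Space X] [SecondCountableTopology X] [ConnectedSpace X], ∀ D ∈ admissibleVacuumData X, ∀ 𝒟 : VacuumCauchyDevelopment D, 𝒟.IsMaximal → Summit.FinalStateConjecture.HasCompleteNullInfinity 𝒟.toCauchyDevelopment → (∃ (m₀ χ : ℝ) (O : Set 𝒟.carrier) (d : QuasiFinalStateDecomposition 𝒟.toSpacetime O 2 ⊤) (R : Fin d.N → ℝ → ℝ), 0 < m₀ ∧ χ < 1 ∧ O = Summit.FinalStateConjecture.exteriorOf 𝒟.toCauchyDevelopment d.charted ∧ Summit.FinalStateConjecture.RaysStayInClosure 𝒟.toCauchyDevelopment O ∧ (∀ i : Fin d.N, Filter.Tendsto (R i) Filter.atTop Filter.atTop ∧ ∀ τ : ℝ, max (Kerr.rPlus (d.mass i) (d.spin i)) 0 + 1 ≤ R i τ) ∧ (∀ τ₁ : ℝ, d.τ₀ < τ₁ → O \ d.certifiedLate R τ₁ ⊆ 𝒟.metric.causalPast 𝒟.timeOrientation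 (d.certifiedSlab R τ₁)) ∧ (∀ i : Fin d.N, Summit.FinalStateConjecture.IsOrthochronous (d.motion i).1) ∧ (∀ (i : Fin d.N) (ρ : ℝ), ∀ᶠ τ in Filter.atTop, ∀ x ∈ (d.background i).truncTimeSlab ρ τ, ∀ w : E4, 𝒟.timeOrientation.IsFutureDirected (mfderiv 𝓘(ℝ, E4) (𝓡 4) (d.chart i) x w) → 0 < ((d.motion i).1 : E4 ≃L[ℝ] E4).symm w 0) ∧ (∀ᶠ τ in Filter.atTop, ∀ x ∈ (Minkowski.backgroundOn d.flatDomain).timeSlab τ, 𝒟.timeOrientation.IsFutureDirected (mfderiv 𝓘(ℝ, E4) (𝓡 4) d.flatChart x (E4.basisVector 0))) ∧ (∀ k : ℕ, Filter.Tendsto (fun τ => 𝒟.toSpacetime.deviationCk (Minkowski.backgroundOn d.flatDomain) d.flatChart k τ) Filter.atTop (nhds 0)) ∧ (∀ (i : Fin d.N) (k : ℕ) (ρ : ℝ) (ε : ENNReal), 0 < ε → ∀ᶠ τ in Filter.atTop, ∃ M a : ℝ, m₀ ≤ M ∧ M ≤ m₀⁻¹ ∧ |a| ≤ χ * M ∧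 𝒟.toSpacetime.truncDeviationCk {d.background i with bilin := boostedKerrBilin (d.motion i).1 (d.motion i).2 M a} (d.chart i) k ρ τ ≤ ε ∧ 𝒟.toSpacetime.truncDeviationCk {d.background i with bilin := boostedKerrBilin (d.motion i).1 (d.motion i).2 M a} (d.chart i) k (R i τ) τ ≤ ε)) → (∃ (O' : Set 𝒟.carrier) (d' : FinalStateDecomposition 𝒟.toSpacetime O' 2), (∀ i, Kerr.IsSubextremal (d'.mass i) (d'.spin i)) ∧ O' = Summit.FinalStateConjecture.exteriorOf 𝒟.toCauchyDevelopment d'.charted ∧ Summit.FinalStateConjecture.RaysStayInClosure 𝒟.toCauchyDevelopment O' ∧ Summit.FinalStateConjecture.HasExhaustiveCharts d' ∧ Summit.FinalStateConjecture.IsFutureOriented d')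

-- earlier DyadicSummability (stmt-FinalStateConjecture-14484, replaced 2026-08-16T23:20:23Z -> stmt-FinalStateConjecture-17489): retired by None — open Literature.Geometry.Lorentzian in ∀ (X : Type) [TopologicalSpace X] [ChartedSpace E3 X] [IsManifold (𝓡 3) ((⊤ : ℕ∞) : WithTop ℕ∞) X] [T2Space X] [SecondCountableTopology X] [ConnectedSpace X], ∀ D ∈ admissibleVacuumData X, ∀ 𝒟 : VacuumCauchyDevelopme
/-- item stmt-FinalStateConjecture-17489 · crux · rank 4 · open · by planner
why it might fail: ℓ≤1 drizzle (infalling mass/momentum aspect of o₂(r⁻¹) data) must be slaved to the charges via the constraints; for N≥2 companions' late emission/torque must be ℓ¹ at the receiver; compactness transfer needs a tame slab gauge, quadratic terms O(δ²) after derivative loss by trapping; θ(χ)→1 as χ→1.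
sources: arXiv:2004.01664, arXiv:2102.11884, arXiv:2111.04489, arXiv:1104.5437, doi:10.1016/j.jmaa.2022.126939, arXiv:2104.11857
[crux] Under the same hypotheses (admissible datum, MGHD with complete 𝓘⁺, an honest subconvergent
final era exactly as in DyadicCapture), there is a reference chart system satisfying the SAME honest
era clauses in which, for every hole i, order k and radius ρ, from some dyadic index n₀ on the
dyadic suprema of the distance to the window family are summable: Σ_n sup over τ ∈ [2^(n₀+n),
2^(n₀+n+1)] of inf over m₀ ≤ M ≤ 1/m₀, |a| ≤ χM of the Cᵏ deviation of (chart i)^*g from boosted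
Kerr–Schild (Λᵢ, cᵢ, M, a) on {t*ᵢ = τ, rᵢ ≤ ρ} is finite — the card's Σδ_k < ∞, the quantitative
heart (renewal inequality: near-zone slaving θ, memory kernel K ∈ ℓ¹, drizzle g ∈ ℓ¹, quadratic
fluxes budgeted; then DiscreteRenewal). [difficulty: open-problem] -/
@[route_item "route-FinalStateConjecture-LogTimeThreeAnnuli"]
def DyadicSummability : Prop :=
  open Literature.Geometry.Lorentzian in ∀ (X : Type) [TopologicalSpace X] [ChartedSpace E3 X] [IsManifold (𝓡 3) ((⊤ : ℕ∞) : WithTop ℕ∞) X] [T2Space X] [SecondCountableTopology X] [ConnectedSpace X], ∀ D ∈ admissibleVacuumData X, ∀ 𝒟 : VacuumCauchyDevelopment D, 𝒟.IsMaximal → Summit.FinalStateConjecture.HasCompleteNullInfinity 𝒟.toCauchyDevelopment → (∃ (m₀ χ : ℝ) (O : Set 𝒟.carrier) (d : QuasiFinalStateDecomposition 𝒟.toSpacetime O 2 ⊤) (R : Fin d.N → ℝ → ℝ), 0 < m₀ ∧ χ < 1 ∧ O = Summit.FinalStateConjecture.exteriorOf 𝒟.toCauchyDevelopment d.charted ∧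 Summit.FinalStateConjecture.RaysStayInClosure 𝒟.toCauchyDevelopment O ∧ (∀ i : Fin d.N, Filter.Tendsto (R i) Filter.atTop Filter.atTop ∧ ∀ τ : ℝ, max (Kerr.rPlus (d.mass i) (d.spin i)) 0 + 1 ≤ R i τ) ∧ (∀ τ₁ : ℝ, d.τ₀ < τ₁ → O \ d.certifiedLate R τ₁ ⊆ 𝒟.metric.causalPast 𝒟.timeOrientation (d.certifiedSlab R τ₁)) ∧ (∀ i : Fin d.N, Summit.FinalStateConjecture.IsOrthochronous (d.motion i).1) ∧ (∀ (i : Fin d.N) (ρ : ℝ), ∀ᶠ τ in Filter.atTop, ∀ x ∈ (d.background i).truncTimeSlab ρ τ, ∀ w : E4, 𝒟.timeOrientation.IsFutureDirected (mfderiv 𝓘(ℝ, E4) (𝓡 4) (d.chart i) x w) → 0 < ((d.motion i).1 : E4 ≃L[ℝ] E4).symm w 0) ∧ (∀ᶠ τ in Filter.atTop, ∀ x ∈ (Minkowski.backgroundOn d.flatDomain).timeSlab τ, 𝒟.timeOrientation.IsFutureDirected (mfderiv 𝓘(ℝ, E4) (𝓡 4) d.flatChart x (E4.basisVector 0))) ∧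 (∀ k : ℕ, Filter.Tendsto (fun τ => 𝒟.toSpacetime.deviationCk (Minkowski.backgroundOn d.flatDomain) d.flatChart k τ) Filter.atTop (nhds 0)) ∧ (∀ (i : Fin d.N) (k : ℕ) (ρ : ℝ) (ε : ENNReal), 0 < ε → ∀ᶠ τ in Filter.atTop, ∃ M a : ℝ, m₀ ≤ M ∧ M ≤ m₀⁻¹ ∧ |a| ≤ χ * M ∧ 𝒟.toSpacetime.truncDeviationCk {d.background i with bilin := boostedKerrBilin (d.motion i).1 (d.motion i).2 M a} (d.chart i) k ρ τ ≤ ε ∧ 𝒟.toSpacetime.truncDeviationCk {d.background i with bilin := boostedKerrBilin (d.motion i).1 (d.motion i).2 M a} (d.chart i) k (R i τ) τ ≤ ε)) → ∃ (m₀ χ : ℝ) (O : Set 𝒟.carrier) (d : QuasiFinalStateDecomposition 𝒟.toSpacetime O 2 ⊤) (R : Fin d.N → ℝ → ℝ), 0 < m₀ ∧ χ < 1 ∧ O = Summit.FinalStateConjecture.exteriorOf 𝒟.toCauchyDevelopment d.charted ∧ Summit.FinalStateConjecture.RaysStayInClosure 𝒟.toCauchyDevelopment O ∧ (∀ i : Fin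 d.N, Filter.Tendsto (R i) Filter.atTop Filter.atTop ∧ ∀ τ : ℝ, max (Kerr.rPlus (d.mass i) (d.spin i)) 0 + 1 ≤ R i τ) ∧ (∀ τ₁ : ℝ, d.τ₀ < τ₁ → O \ d.certifiedLate R τ₁ ⊆ 𝒟.metric.causalPast 𝒟.timeOrientation (d.certifiedSlab R τ₁)) ∧ (∀ i : Fin d.N, Summit.FinalStateConjecture.IsOrthochronous (d.motion i).1) ∧ (∀ (i : Fin d.N) (ρ : ℝ), ∀ᶠ τ in Filter.atTop, ∀ x ∈ (d.background i).truncTimeSlab ρ τ, ∀ w : E4, 𝒟.timeOrientation.IsFutureDirected (mfderiv 𝓘(ℝ, E4) (𝓡 4) (d.chart i) x w) → 0 < ((d.motion i).1 : E4 ≃L[ℝ] E4).symm w 0) ∧ (∀ᶠ τ in Filter.atTop, ∀ x ∈ (Minkowski.backgroundOn d.flatDomain).timeSlab τ, 𝒟.timeOrientation.IsFutureDirected (mfderiv 𝓘(ℝ, E4) (𝓡 4) d.flatChart x (E4.basisVector 0))) ∧ (∀ k : ℕ, Filter.Tendsto (fun τ => 𝒟.toSpacetime.deviationCk (Minkowski.backgroundOn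 d.flatDomain) d.flatChart k τ) Filter.atTop (nhds 0)) ∧ (∀ (i : Fin d.N) (k : ℕ) (ρ : ℝ) (ε : ENNReal), 0 < ε → ∀ᶠ τ in Filter.atTop, ∃ M a : ℝ, m₀ ≤ M ∧ M ≤ m₀⁻¹ ∧ |a| ≤ χ * M ∧ 𝒟.toSpacetime.truncDeviationCk {d.background i with bilin := boostedKerrBilin (d.motion i).1 (d.motion i).2 M a} (d.chart i) k ρ τ ≤ ε ∧ 𝒟.toSpacetime.truncDeviationCk {d.background i with bilin := boostedKerrBilin (d.motion i).1 (d.motion i).2 M a} (d.chart i) k (R i τ) τ ≤ ε) ∧ (∀ (i : Fin d.N) (k : ℕ) (ρ : ℝ), ∃ n₀ : ℕ, (∑' n : ℕ, ⨆ τ ∈ Set.Icc ((2 : ℝ) ^ (n₀ + n)) ((2 : ℝ) ^ (n₀ + n + 1)), ⨅ (M : ℝ) (a : ℝ) (_ : m₀ ≤ M ∧ M ≤ m₀⁻¹ ∧ |a| ≤ χ * M), 𝒟.toSpacetime.truncDeviationCk {d.background i with bilin := boostedKerrBilin (d.motion i).1 (d.motion i).2 M a} (d.chart i) k ρ τ)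 ≠ ⊤)

-- earlier SubconvergentEraGeneric (stmt-FinalStateConjecture-14485, replaced 2026-08-16T23:20:23Z -> stmt-FinalStateConjecture-17490): retired by None — open Literature.Geometry.Lorentzian in ∀ (X : Type) [TopologicalSpace X] [ChartedSpace E3 X] [IsManifold (𝓡 3) ((⊤ : ℕ∞) : WithTop ℕ∞) X] [T2Space X] [SecondCountableTopology X] [ConnectedSpace X], InitialDataSet.IsChristodoulouGeneric (admissibleVa
/-- item stmt-FinalStateConjecture-17490 · crux · rank 5 · open · by planner
why it might fail: Contains weak cosmic censorship and 'ω-limit ⊂ sub-extremal Kerr' outright (AIK rigidity only near Kerr); extremal limits and rough-tailed data (Cᵏ-closeness asked for ALL k, admissible tails control 2 derivatives at i⁰) must now be escaped by TAME IMMERSED curves on the fixed end.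
sources: DafermosLuk2017, Christodoulou1999, arXiv:2402.10190, arXiv:2211.15742, AlexakisIonescuKlainerman2010, arXiv:2403.03470
[crux] IMPORT (the producers are the ω-limit / Liouville / quiet-window / kinetic-rigidity routes
together with generic censorship and generic sub-extremality): for every connected Hausdorff
second-countable smooth 3-manifold X, the property "EVERY maximal vacuum Cauchy development of the
datum has complete 𝓘⁺ (Summit.FinalStateConjecture.HasCompleteNullInfinity) AND carries an honest
subconvergent final era (as in DyadicCapture: reference N-hole chart geometry with O = exteriorOf
charted, RaysStayInClosure O, honest radii, causal exhaustion, orthochronous motions and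
future-oriented chart time on the certified slabs, flat zone → η in every Cᵏ, near zones eventually
ε-close in every Cᵏ on fixed and on growing slabs to SOME Kerr of a compact sub-extremal window, the
member free to wander)" is TAME Christodoulou-generic of codimension ≥ 1 in admissibleVacuumData X
(InitialDataSet.IsTameChristodoulouGeneric … 1, re-type T2 (A): witness families live on ONE fixed
asymptotically flat end with continuous mass, are weighted-C² continuous and immersed at c = 0). One
generic clause only, because curve-genericity is monotone but not closed under ∧. [difficulty:
open-problem] -/
@[route_item "route-FinalStateConjecture-LogTimeThreeAnnuli"]
def SubconvergentEraGeneric : Prop :=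
  open Literature.Geometry.Lorentzian in ∀ (X : Type) [TopologicalSpace X] [ChartedSpace E3 X] [IsManifold (𝓡 3) ((⊤ : ℕ∞) : WithTop ℕ∞) X] [T2Space X] [SecondCountableTopology X] [ConnectedSpace X], InitialDataSet.IsTameChristodoulouGeneric (admissibleVacuumData X) (fun D => ∀ 𝒟 : VacuumCauchyDevelopment D, 𝒟.IsMaximal → Summit.FinalStateConjecture.HasCompleteNullInfinity 𝒟.toCauchyDevelopment ∧ (∃ (m₀ χ : ℝ) (O : Set 𝒟.carrier) (d : QuasiFinalStateDecomposition 𝒟.toSpacetime O 2 ⊤) (R : Fin d.N → ℝ → ℝ), 0 < m₀ ∧ χ < 1 ∧ O = Summit.FinalStateConjecture.exteriorOf 𝒟.toCauchyDevelopment d.charted ∧ Summit.FinalStateConjecture.RaysStayInClosure 𝒟.toCauchyDevelopment O ∧ (∀ i : Fin d.N, Filter.Tendsto (R i) Filter.atTop Filter.atTop ∧ ∀ τ : ℝ, max (Kerr.rPlus (d.mass i) (d.spin i)) 0 + 1 ≤ R i τ) ∧ (∀ τ₁ : ℝ, d.τ₀ < τ₁ → O \ d.certifiedLate R τ₁ ⊆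 𝒟.metric.causalPast 𝒟.timeOrientation (d.certifiedSlab R τ₁)) ∧ (∀ i : Fin d.N, Summit.FinalStateConjecture.IsOrthochronous (d.motion i).1) ∧ (∀ (i : Fin d.N) (ρ : ℝ), ∀ᶠ τ in Filter.atTop, ∀ x ∈ (d.background i).truncTimeSlab ρ τ, ∀ w : E4, 𝒟.timeOrientation.IsFutureDirected (mfderiv 𝓘(ℝ, E4) (𝓡 4) (d.chart i) x w) → 0 < ((d.motion i).1 : E4 ≃L[ℝ] E4).symm w 0) ∧ (∀ᶠ τ in Filter.atTop, ∀ x ∈ (Minkowski.backgroundOn d.flatDomain).timeSlab τ, 𝒟.timeOrientation.IsFutureDirected (mfderiv 𝓘(ℝ, E4) (𝓡 4) d.flatChart x (E4.basisVector 0))) ∧ (∀ k : ℕ, Filter.Tendsto (fun τ => 𝒟.toSpacetime.deviationCk (Minkowski.backgroundOn d.flatDomain) d.flatChart k τ) Filter.atTop (nhds 0)) ∧ (∀ (i : Fin d.N) (k : ℕ) (ρ : ℝ) (ε : ENNReal), 0 < ε → ∀ᶠ τ in Filter.atTop, ∃ M a : ℝ, m₀ ≤ M ∧ M ≤ m₀⁻¹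 ∧ |a| ≤ χ * M ∧ 𝒟.toSpacetime.truncDeviationCk {d.background i with bilin := boostedKerrBilin (d.motion i).1 (d.motion i).2 M a} (d.chart i) k ρ τ ≤ ε ∧ 𝒟.toSpacetime.truncDeviationCk {d.background i with bilin := boostedKerrBilin (d.motion i).1 (d.motion i).2 M a} (d.chart i) k (R i τ) τ ≤ ε))) 1

/-- item stmt-FinalStateConjecture-9937 · crux · rank 9 · open · by planner
why it might fail: True in print (CBG 1969 Thm 3) but an undischarged XL fact typed over the REPAIRED prelude: IsMaximal makes EVERY typed VacuumCauchyDevelopment.{0} of D embed ι-compatibly into one 𝒟; the first rendering (choquetBruhat_geroch_exists_mghd) was refuted as typed — a rogue/empty typed class kills it.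
sources: ChoquetBruhatGeroch1969CMP, Sbierski2016AHP, Ringstrom2009, Literature.Geometry.Lorentzian.choquetBruhat_geroch_exists_mghd_cauchy, Literature.Geometry.Lorentzian.not_choquetBruhat_geroch_exists_mghd
[support] every admissible datum has a maximal globally hyperbolic vacuum development, stated over
the repaired structure `VacuumCauchyDevelopment` (the corrected form of the deprecated
`choquetBruhat_geroch_exists_mghd`, recorded in `CauchyProblemExistenceDefect`);
Choquet-Bruhat–Geroch 1969 Thm. 3, Sbierski 2016 Thm. 2.6. Known theorem; large formalisation;
shared by every route of this summit. [difficulty: XL] -/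
@[route_item "route-FinalStateConjecture-LogTimeThreeAnnuli"]
def MGHDExists : Prop :=
  ∀ (X : Type) [TopologicalSpace X] [ChartedSpace Literature.Geometry.Lorentzian.E3 X] [IsManifold (𝓡 3) ((⊤ : ℕ∞) : WithTop ℕ∞) X] [T2Space X] [SecondCountableTopology X] [ConnectedSpace X], ∀ D ∈ Literature.Geometry.Lorentzian.admissibleVacuumData X, ∃ 𝒟 : Literature.Geometry.Lorentzian.VacuumCauchyDevelopment D, 𝒟.IsMaximal

-- item stmt-FinalStateConjecture-13464 · support · rank 3 · open · by planner — informal only, no Lean statement yet: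
--   [crux] LINEAR NEAR-ZONE SLAVING MODULO MODULI (card K1 in the planner's corrected form; the 'gap'
--   input of the renewal scheme). On exact sub-extremal Kerr(M,a), |a| < M, for the linearised vacuum
--   Einstein equations (Teukolsky system plus metric/gauge completion in a horizon-penetrating gauge)
--   there are a derivative loss s, a constant C and a window length L₀ = L₀(M, a, R, R') such that for
--   every L ≥ L₀, every start time T and every smooth solution h on the truncated exterior {r₊ ≤ r ≤ R'}
--   × [T, T + 2L]: the Cᵐ size of h on {r ≤ R} × [T + L, T + 2L], taken modulo the linearised Kerr
--   family (δM,

-- item stmt-FinalStateConjecture-13479 · support · rank 6 · open · by planner — informal only, no Lean statement yet: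
--   [crux] SUMMABLE COLLAR FORCING IN A SUBCONVERGENT ERA (card K3; the g ∈ ℓ¹ and K ∈ ℓ¹ inputs of the
--   renewal inequality behind DyadicSummability). For an MGHD of an admissible datum with complete 𝓘⁺
--   carrying a subconvergent final era (the hypothesis of DyadicCapture), for each hole i, order m and
--   radii R < R': the dyadic suprema f_n := sup over chart times τ ∈ [2ⁿ, 2ⁿ⁺¹] of the C^{m+s} distance,
--   modulo the window family (M, a) and Poincaré gauge, of (chart i)^* g from boosted Kerr–Schild on the
--   COLLAR slabs {t*ᵢ = τ, R ≤ rᵢ ≤ R'} are summable, Σ_n f_n < ∞, and so is the sequence of quadratic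
--   fl

-- earlier DiscreteRenewal (stmt-FinalStateConjecture-14486, replaced 2026-08-16T23:20:23Z -> stmt-FinalStateConjecture-17491): proved by Summit.FinalStateConjecture.FinalStateConjecture.Theorems.discreteRenewal_proof @ 9a1ae8a04fd4 — ∀ (θ : ℝ) (K g δ : ℕ → ℝ), 0 ≤ θ → (∀ n, 0 ≤ K n) → (∀ n, 0 ≤ g n) → (∀ n, 0 ≤ δ n) → Summable K → Summable g → θ + ∑' n, K n < 1 → (∀ n, δ (n + 1) ≤ θ * δ n + (∑ j ∈ F
/-- item stmt-FinalStateConjecture-17491 · support · rank 9 · open · by planner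
sources: doi:10.2307/2006981, doi:10.1007/bf01231543
[support] Discrete renewal / Young lemma (card P1): nonnegative sequences with δ_{n+1} ≤ θδ_n +
Σ_{j≤n} K_{n−j}δ_j + g_n, K, g ∈ ℓ¹, ΣK + θ < 1 are summable with Σδ ≤ (δ₀ + Σg)/(1 − θ − ΣK). Pure
real analysis over Mathlib. PROVED in the tree as `Theorems.discreteRenewal_proof`
(Theorems/LogTimeThreeAnnuliDiscreteRenewal.lean, former item stmt-FinalStateConjecture-14486), but
that module imports this route file, so the gate cannot link it (`_holds` import cycle); restated
here with the smallness hypothesis written `ΣK + θ < 1` (logically identical; the landed proof still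
elaborates against it) so that the route file renders. PROVERS: re-close ONLY from a module that
does NOT import this Theses file (state the type inlined; the 40-line proof transfers verbatim).
[difficulty: provable-now] -/
@[route_item "route-FinalStateConjecture-LogTimeThreeAnnuli"]
def DiscreteRenewal : Prop :=
  ∀ (θ : ℝ) (K g δ : ℕ → ℝ), 0 ≤ θ → (∀ n, 0 ≤ K n) → (∀ n, 0 ≤ g n) → (∀ n, 0 ≤ δ n) → Summable K → Summable g → ∑' n, K n + θ < 1 → (∀ n, δ (n + 1) ≤ θ * δ n + (∑ j ∈ Finset.range (n + 1), K (n - j) * δ j) + g n) → Summable δ ∧ ∑' n, δ n ≤ (δ 0 + ∑' n, g n) / (1 - θ - ∑' n, K n)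

-- earlier Assembly (stmt-FinalStateConjecture-14487, replaced 2026-08-16T23:20:23Z -> stmt-FinalStateConjecture-17492): proved by Summit.FinalStateConjecture.FinalStateConjecture.Theorems.logTimeThreeAnnuli_assembly_proof @ e4b0299284b9 — SubconvergentEraGeneric → DyadicCapture → MGHDExists → FinalStateConjecture
/-- item stmt-FinalStateConjecture-17492 · assembly · rank 1 · closed · proved by Summit.FinalStateConjecture.FinalStateConjecture.Theorems.logTimeThreeAnnuli_assembly_proof @ 65b02d71cca1 (prover) · by planner
sources: DafermosLuk2017, Christodoulou1999
[assembly] (SubconvergentEraGeneric ∧ DyadicCapture ∧ MGHDExists) → FinalStateConjecture — the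
UNCURRIED deciding theorem (`fun h ↦ closes h.1 h.2.1 h.2.2`; `closes` below is sorry-free).
Replaces the curried stmt-FinalStateConjecture-14487 (proved 2026-08-15 by
Theorems/LogTimeThreeAnnuliAssembly.lean, a module importing this route file ⇒ un-linkable `_holds`,
and whose proof the Statement re-type T2 broke anyway). PROVERS: nothing is gained by closing this
bookkeeping item — `closes` already carries the proof; work the cruxes. If you do close it, do so
ONLY from a module that does NOT import this Theses file (inline the three item bodies, cf.
Theorems/BartnikGapSettlingAssembly.lean). -/
@[route_item "route-FinalStateConjecture-LogTimeThreeAnnuli"]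
def Assembly : Prop :=
  SubconvergentEraGeneric ∧ DyadicCapture ∧ MGHDExists → _root_.FinalStateConjecture

-- `Assembly` holds: proved by `Summit.FinalStateConjecture.FinalStateConjecture.Theorems.logTimeThreeAnnuli_assembly_proof` @ 65b02d71cca1 (its module imports this route file, so no `_holds` link can be stated here).

/-! D-0027 §2.1 — DECIDING THEOREM (planner-authored via `route open/edit --closes-file`; by planner-rbadge-FinalStateConjecture-LogTimeThr-f3d8145a-g2-0 2026-08-16T23:43:33Z):
its hypotheses are this route's items and its conclusion the sub-problem Statement (glue_lint), and it elaborates with this file. -/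

@[closes "route-FinalStateConjecture-LogTimeThreeAnnuli"] theorem closes : SubconvergentEraGeneric → DyadicCapture → MGHDExists → FinalStateConjecture := by
  intro hG hC hM X _ _ _ _ _ _ d hd
  obtain ⟨e, F, hF, hI, h0, hinj, hadm, hE⟩ := hG X d ⟨hd.1, fun h => hd.2 ⟨hM X d hd.1,
    fun 𝒟 hmax => ⟨(h 𝒟 hmax).1, hC X d hd.1 𝒟 hmax (h 𝒟 hmax).1 (h 𝒟 hmax).2⟩⟩⟩
  exact ⟨e, F, hF, hI, h0, hinj, hadm, fun c hc hmem => hE c hc ⟨hmem.1, fun h => hmem.2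
    ⟨hM X (F c) hmem.1, fun 𝒟 hmax => ⟨(h 𝒟 hmax).1,
      hC X (F c) hmem.1 𝒟 hmax (h 𝒟 hmax).1 (h 𝒟 hmax).2⟩⟩⟩⟩

end Summit.FinalStateConjecture.FinalStateConjecture.Theses.LogTimeThreeAnnuli
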